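import Mathlib.Analysis.InnerProductSpace.PiL2

/-!
# Route `ReggeStarCoercivity`, crux `DefectFreeCrystallizes` (stmt-AtomisticToContinuum-13603), line `palm-good-law` (v38):
# auxiliary inner-product-space lemmas for the engine tool `stub_procrustes` (file `…DefectFreeCrystallizesProcrustes`)

Generic finite-dimensional pieces of the local quantitative rigidity (Procrustes) estimate, for an arbitrary real inner
product space `E`:
* `sum_sum_mul_smul` — rearrangement of a double linear combination;
* `pairing_sq_le` — the configuration-pairing Cauchy–Schwarz estimate
  `(⟪Σ α_i y_i, Σ β_j y_j⟫ − ⟪Σ α_i p_i, Σ β_j p_j⟫)² ≤ ‖α‖² ‖β‖² Σ_{ij} (⟪y i, y j⟫ − ⟪p i, p j⟫)²`;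
* `gram_sq_le_data` — polarisation: `Σ_{ij} (⟪y i, y j⟫ − ⟪p i, p j⟫)² ≤ 2 (n+1) · (rooted squared-distance data)`;
* `normalize_near`, `abs_inner_le_of_near`, `le_four_mul_of_sq_half_le` — elementary estimates;
* `gramSchmidt_near` — explicit three-step Gram–Schmidt of a triple with Gram matrix `η`-close to the identity
  (`η ≤ 1/200`) moves each vector by at most `16 η`;
* `exists_isometry_near` — hence a linear isometry `A` (`OrthonormalBasis.equiv`) with
  `‖A z − Σ_k ⟪e k, z⟫ v_k‖² ≤ 768 η² ‖z‖²`.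
All `[folklore]`; no definitions, Mathlib only.
-/

noncomputable section

open scoped BigOperators RealInnerProductSpace

namespace Summit.AtomisticToContinuum.Crystallization.Theorems.PalmGoodLaw.Procrustes

variable {E : Type*} [NormedAddCommGroup E] [InnerProductSpace ℝ E]

/-- Rearrangement: a linear combination with bilinear coefficients `Σ_k a_k c_{ki}` is the `a`-combination of
the `c_k`-combinations. [folklore] -/
theorem sum_sum_mul_smul {ι κ : Type*} [Fintype ι] [Fintype κ] (a : κ → ℝ) (c : κ → ι → ℝ)
    (q : ι → E) : ∑ i, (∑ k, a k * c k i) • q i = ∑ k, a k • ∑ i, c k i • q i := by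
  simp_rw [Finset.sum_smul, mul_smul, Finset.smul_sum]
  exact Finset.sum_comm

/-- **Configuration pairing.**  The Gram pairing of two coefficient vectors changes, between two
configurations `p` and `y`, by at most `‖α‖ ‖β‖ ‖G^y − G^p‖_F` (squared form). [folklore] -/
theorem pairing_sq_le {ι : Type*} [Fintype ι] (p y : ι → E) (α β : ι → ℝ) :
    (⟪∑ i, α i • y i, ∑ j, β j • y j⟫ - ⟪∑ i, α i • p i, ∑ j, β j • p j⟫) ^ 2 ≤
      (∑ i, α i ^ 2) * (∑ j, β j ^ 2) * ∑ i, ∑ j, (⟪y i, y j⟫ - ⟪p i, p j⟫) ^ 2 := by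
  have hexp : ⟪∑ i, α i • y i, ∑ j, β j • y j⟫ - ⟪∑ i, α i • p i, ∑ j, β j • p j⟫ =
      ∑ i, α i * ∑ j, β j * (⟪y i, y j⟫ - ⟪p i, p j⟫) := by
    have h1 : ∀ q : ι → E,
        ⟪∑ i, α i • q i, ∑ j, β j • q j⟫ = ∑ i, α i * ∑ j, β j * ⟪q i, q j⟫ := by
      intro q
      rw [sum_inner]
      refine Finset.sum_congr rfl fun i _ => ?_
      rw [real_inner_smul_left, inner_sum]
      congr 1
      refine Finset.sum_congr rfl fun j _ => ?_
      rw [real_inner_smul_right]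
    rw [h1 y, h1 p, ← Finset.sum_sub_distrib]
    refine Finset.sum_congr rfl fun i _ => ?_
    rw [← mul_sub, ← Finset.sum_sub_distrib]
    congr 1
    refine Finset.sum_congr rfl fun j _ => ?_
    ring
  rw [hexp]
  calc (∑ i, α i * ∑ j, β j * (⟪y i, y j⟫ - ⟪p i, p j⟫)) ^ 2
      ≤ (∑ i, α i ^ 2) * ∑ i, (∑ j, β j * (⟪y i, y j⟫ - ⟪p i, p j⟫)) ^ 2 :=
        Finset.sum_mul_sq_le_sq_mul_sq _ _ _
    _ ≤ (∑ i, α i ^ 2) * ∑ i, (∑ j, β j ^ 2) * ∑ j, (⟪y i, y j⟫ - ⟪p i, p j⟫) ^ 2 :=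
        mul_le_mul_of_nonneg_left
          (Finset.sum_le_sum fun i _ => Finset.sum_mul_sq_le_sq_mul_sq _ _ _)
          (Finset.sum_nonneg fun i _ => sq_nonneg _)
    _ = (∑ i, α i ^ 2) * (∑ j, β j ^ 2) * ∑ i, ∑ j, (⟪y i, y j⟫ - ⟪p i, p j⟫) ^ 2 := by
        rw [← Finset.mul_sum]; ring

/-- **Polarisation.**  The squared Frobenius deviation of the Gram matrices is dominated by the rooted
squared-distance data `Σ_i (‖y i‖² − ‖p i‖²)² + Σ_i Σ_j (‖y i − y j‖² − ‖p i − p j‖²)²`. [folklore] -/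
theorem gram_sq_le_data {n : ℕ} (p y : Fin n → E) :
    ∑ i, ∑ j, (⟪y i, y j⟫ - ⟪p i, p j⟫) ^ 2 ≤
      2 * (n + 1) * (∑ i, (‖y i‖ ^ 2 - ‖p i‖ ^ 2) ^ 2 +
        ∑ i, ∑ j, (‖y i - y j‖ ^ 2 - ‖p i - p j‖ ^ 2) ^ 2) := by
  set a : Fin n → ℝ := fun i => ‖y i‖ ^ 2 - ‖p i‖ ^ 2 with ha
  set b : Fin n → Fin n → ℝ := fun i j => ‖y i - y j‖ ^ 2 - ‖p i - p j‖ ^ 2 with hb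
  have hterm : ∀ i j, (⟪y i, y j⟫ - ⟪p i, p j⟫) ^ 2 ≤
      3 / 4 * a i ^ 2 + 3 / 4 * a j ^ 2 + 3 / 4 * b i j ^ 2 := by
    intro i j
    have hij : 2 * (⟪y i, y j⟫ - ⟪p i, p j⟫) = a i + a j - b i j := by
      simp only [ha, hb, norm_sub_sq_real]; ring
    nlinarith [sq_nonneg (a i - a j), sq_nonneg (a i + b i j), sq_nonneg (a j + b i j)]
  have hA : 0 ≤ ∑ i, a i ^ 2 := Finset.sum_nonneg fun i _ => sq_nonneg _
  have hB : 0 ≤ ∑ i, ∑ j, b i j ^ 2 :=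
    Finset.sum_nonneg fun i _ => Finset.sum_nonneg fun j _ => sq_nonneg _
  have hn : (0 : ℝ) ≤ n := Nat.cast_nonneg n
  calc ∑ i, ∑ j, (⟪y i, y j⟫ - ⟪p i, p j⟫) ^ 2
      ≤ ∑ i, ∑ j, (3 / 4 * a i ^ 2 + 3 / 4 * a j ^ 2 + 3 / 4 * b i j ^ 2) :=
        Finset.sum_le_sum fun i _ => Finset.sum_le_sum fun j _ => hterm i j
    _ = 3 / 4 * (n * ∑ i, a i ^ 2) + 3 / 4 * (n * ∑ i, a i ^ 2) + 3 / 4 * ∑ i, ∑ j, b i j ^ 2 := by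
        simp only [Finset.sum_add_distrib, Finset.sum_const, Finset.card_univ, Fintype.card_fin,
          nsmul_eq_mul, ← Finset.mul_sum]
        ring
    _ ≤ 2 * (n + 1) * (∑ i, a i ^ 2 + ∑ i, ∑ j, b i j ^ 2) := by
        nlinarith [mul_nonneg hn hA, mul_nonneg hn hB]

/-- Normalising a vector of nearly unit length moves it by at most `|‖w‖² − 1|`. [folklore] -/
theorem normalize_near (w : E) {β : ℝ} (hβ : β ≤ 1 / 2) (hw : |‖w‖ ^ 2 - 1| ≤ β) :
    ‖(‖w‖⁻¹ : ℝ) • w‖ = 1 ∧ ‖(‖w‖⁻¹ : ℝ) • w - w‖ ≤ β := by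
  have hw' := abs_le.mp hw
  have hpos : 0 < ‖w‖ := by
    rcases (norm_nonneg w).eq_or_lt with h | h
    · rw [← h] at hw'; norm_num at hw'; linarith
    · exact h
  have hne : ‖w‖ ≠ 0 := hpos.ne'
  refine ⟨?_, ?_⟩
  · rw [norm_smul, norm_inv, norm_norm, inv_mul_cancel₀ hne]
  · have : (‖w‖⁻¹ : ℝ) • w - w = ((‖w‖⁻¹ : ℝ) - 1) • w := by rw [sub_smul, one_smul]
    rw [this, norm_smul, Real.norm_eq_abs]
    have h2 : |(‖w‖⁻¹ : ℝ) - 1| * ‖w‖ = |1 - ‖w‖| := by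
      rw [show (1 : ℝ) - ‖w‖ = ((‖w‖⁻¹ : ℝ) - 1) * ‖w‖ by
        rw [sub_mul, inv_mul_cancel₀ hne, one_mul], abs_mul, abs_of_pos hpos]
    rw [h2, abs_le]
    constructor
    · nlinarith [hw'.1, hw'.2, hpos]
    · nlinarith [hw'.1, hw'.2, hpos]

/-- Elementary: `K ≥ 0`, `(t/2)² ≤ K t` force `t ≤ 4 K`. [folklore] -/
theorem le_four_mul_of_sq_half_le {t K : ℝ} (hK : 0 ≤ K) (h : (t / 2) ^ 2 ≤ K * t) :
    t ≤ 4 * K := by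
  by_contra hlt
  have hlt := not_le.mp hlt
  have htpos : 0 < t := lt_of_le_of_lt (by positivity) hlt
  nlinarith

/-- Inner products against a perturbed vector. [folklore] -/
theorem abs_inner_le_of_near (u v x : E) : |⟪u, x⟫| ≤ |⟪v, x⟫| + ‖u - v‖ * ‖x‖ := by
  have h : ⟪u, x⟫ = ⟪v, x⟫ + ⟪u - v, x⟫ := by rw [inner_sub_left]; ring
  rw [h]
  exact (abs_add_le _ _).trans (by gcongr; exact abs_real_inner_le_norm _ _)

/-- **Quantitative Gram–Schmidt for a nearly orthonormal triple.**  If the Gram matrix of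
`v₀, v₁, v₂` is entrywise `η`-close to the identity (`η ≤ 1/200`), Gram–Schmidt produces an
orthonormal triple moving each vector by at most `16 η`. [folklore] -/
theorem gramSchmidt_near (v : Fin 3 → E) {η : ℝ} (hη : η ≤ 1 / 200)
    (h : ∀ k l, |⟪v k, v l⟫ - (if k = l then 1 else 0)| ≤ η) :
    ∃ u : Fin 3 → E, Orthonormal ℝ u ∧ ∀ k, ‖u k - v k‖ ≤ 16 * η := by
  have hη0 : 0 ≤ η := (abs_nonneg _).trans (h 0 0)
  have hd : ∀ k, |‖v k‖ ^ 2 - 1| ≤ η := fun k => by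
    have := h k k
    rwa [if_pos rfl, real_inner_self_eq_norm_sq] at this
  have ho : ∀ k l, k ≠ l → |⟪v k, v l⟫| ≤ η := fun k l hkl => by
    have := h k l
    rwa [if_neg hkl, sub_zero] at this
  have hn2 : ∀ k, ‖v k‖ ≤ 2 := fun k => by
    have := (abs_le.mp (hd k)).2
    nlinarith [norm_nonneg (v k)]
  -- step 0
  obtain ⟨u0, hu0def⟩ : ∃ u0 : E, u0 = (‖v 0‖⁻¹ : ℝ) • v 0 := ⟨_, rfl⟩
  obtain ⟨hu0n, hu0d⟩ : ‖u0‖ = 1 ∧ ‖u0 - v 0‖ ≤ η := by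
    rw [hu0def]; exact normalize_near (v 0) (by linarith) (hd 0)
  have hu0sq : ⟪u0, u0⟫ = 1 := by rw [real_inner_self_eq_norm_sq, hu0n, one_pow]
  -- step 1
  have hc : |⟪u0, v 1⟫| ≤ 3 * η :=
    calc |⟪u0, v 1⟫| ≤ |⟪v 0, v 1⟫| + ‖u0 - v 0‖ * ‖v 1‖ := abs_inner_le_of_near _ _ _
      _ ≤ η + η * 2 :=
          add_le_add (ho 0 1 (by decide)) (mul_le_mul hu0d (hn2 1) (norm_nonneg _) hη0)
      _ = 3 * η := by ring
  obtain ⟨w1, hw1def⟩ : ∃ w1 : E, w1 = v 1 - ⟪u0, v 1⟫ • u0 := ⟨_, rfl⟩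
  have hw1o : ⟪u0, w1⟫ = 0 := by
    rw [hw1def, inner_sub_right, real_inner_smul_right, hu0sq, mul_one, sub_self]
  have hw1d : ‖w1 - v 1‖ ≤ 3 * η := by
    rw [hw1def, sub_sub_cancel_left, norm_neg, norm_smul, hu0n, mul_one, Real.norm_eq_abs]
    exact hc
  have hw1sq : ‖w1‖ ^ 2 = ‖v 1‖ ^ 2 - ⟪u0, v 1⟫ ^ 2 :=
    calc ‖w1‖ ^ 2 = ⟪w1, w1⟫ := (real_inner_self_eq_norm_sq w1).symm
      _ = ⟪w1, v 1 - ⟪u0, v 1⟫ • u0⟫ := by rw [← hw1def]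
      _ = ⟪w1, v 1⟫ := by
          rw [inner_sub_right, real_inner_smul_right, real_inner_comm u0 w1, hw1o, mul_zero,
            sub_zero]
      _ = ⟪v 1 - ⟪u0, v 1⟫ • u0, v 1⟫ := by rw [← hw1def]
      _ = ‖v 1‖ ^ 2 - ⟪u0, v 1⟫ ^ 2 := by
          rw [inner_sub_left, real_inner_smul_left, real_inner_self_eq_norm_sq]; ring
  have hw1n : |‖w1‖ ^ 2 - 1| ≤ 2 * η := by
    have h9 : ⟪u0, v 1⟫ ^ 2 ≤ (3 * η) ^ 2 := by
      rw [← sq_abs]; exact pow_le_pow_left₀ (abs_nonneg _) hc 2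
    have := abs_le.mp (hd 1)
    rw [hw1sq, abs_le]
    constructor <;> nlinarith
  obtain ⟨u1, hu1def⟩ : ∃ u1 : E, u1 = (‖w1‖⁻¹ : ℝ) • w1 := ⟨_, rfl⟩
  obtain ⟨hu1n, hu1d⟩ : ‖u1‖ = 1 ∧ ‖u1 - w1‖ ≤ 2 * η := by
    rw [hu1def]; exact normalize_near w1 (by linarith) hw1n
  have hu1sq : ⟪u1, u1⟫ = 1 := by rw [real_inner_self_eq_norm_sq, hu1n, one_pow]
  have h01 : ⟪u0, u1⟫ = 0 := by rw [hu1def, real_inner_smul_right, hw1o, mul_zero]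
  have h10 : ⟪u1, u0⟫ = 0 := (real_inner_comm u0 u1).trans h01
  have hu1v : ‖u1 - v 1‖ ≤ 5 * η :=
    calc ‖u1 - v 1‖ = ‖(u1 - w1) + (w1 - v 1)‖ := by rw [sub_add_sub_cancel]
      _ ≤ ‖u1 - w1‖ + ‖w1 - v 1‖ := norm_add_le _ _
      _ ≤ 2 * η + 3 * η := add_le_add hu1d hw1d
      _ = 5 * η := by ring
  -- step 2
  have hc0 : |⟪u0, v 2⟫| ≤ 3 * η :=
    calc |⟪u0, v 2⟫| ≤ |⟪v 0, v 2⟫| + ‖u0 - v 0‖ * ‖v 2‖ := abs_inner_le_of_near _ _ _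
      _ ≤ η + η * 2 :=
          add_le_add (ho 0 2 (by decide)) (mul_le_mul hu0d (hn2 2) (norm_nonneg _) hη0)
      _ = 3 * η := by ring
  have hc1 : |⟪u1, v 2⟫| ≤ 11 * η :=
    calc |⟪u1, v 2⟫| ≤ |⟪v 1, v 2⟫| + ‖u1 - v 1‖ * ‖v 2‖ := abs_inner_le_of_near _ _ _
      _ ≤ η + 5 * η * 2 :=
          add_le_add (ho 1 2 (by decide)) (mul_le_mul hu1v (hn2 2) (norm_nonneg _) (by linarith))
      _ = 11 * η := by ring
  obtain ⟨w2, hw2def⟩ : ∃ w2 : E, w2 = v 2 - ⟪u0, v 2⟫ • u0 - ⟪u1, v 2⟫ • u1 := ⟨_, rfl⟩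
  have hw2o0 : ⟪u0, w2⟫ = 0 := by
    rw [hw2def, inner_sub_right, inner_sub_right, real_inner_smul_right, real_inner_smul_right,
      hu0sq, h01]; ring
  have hw2o1 : ⟪u1, w2⟫ = 0 := by
    rw [hw2def, inner_sub_right, inner_sub_right, real_inner_smul_right, real_inner_smul_right,
      hu1sq, h10]; ring
  have hw2d : ‖w2 - v 2‖ ≤ 14 * η := by
    have : w2 - v 2 = -(⟪u0, v 2⟫ • u0 + ⟪u1, v 2⟫ • u1) := by rw [hw2def]; abel
    rw [this, norm_neg]
    calc ‖⟪u0, v 2⟫ • u0 + ⟪u1, v 2⟫ • u1‖ ≤ ‖⟪u0, v 2⟫ • u0‖ + ‖⟪u1, v 2⟫ • u1‖ :=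
          norm_add_le _ _
      _ = |⟪u0, v 2⟫| + |⟪u1, v 2⟫| := by
          rw [norm_smul, norm_smul, hu0n, hu1n, mul_one, mul_one, Real.norm_eq_abs,
            Real.norm_eq_abs]
      _ ≤ 3 * η + 11 * η := add_le_add hc0 hc1
      _ = 14 * η := by ring
  have hw2sq : ‖w2‖ ^ 2 = ‖v 2‖ ^ 2 - ⟪u0, v 2⟫ ^ 2 - ⟪u1, v 2⟫ ^ 2 :=
    calc ‖w2‖ ^ 2 = ⟪w2, w2⟫ := (real_inner_self_eq_norm_sq w2).symm
      _ = ⟪w2, v 2 - ⟪u0, v 2⟫ • u0 - ⟪u1, v 2⟫ • u1⟫ := by rw [← hw2def]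
      _ = ⟪w2, v 2⟫ := by
          rw [inner_sub_right, inner_sub_right, real_inner_smul_right, real_inner_smul_right,
            real_inner_comm u0 w2, real_inner_comm u1 w2, hw2o0, hw2o1]; ring
      _ = ⟪v 2 - ⟪u0, v 2⟫ • u0 - ⟪u1, v 2⟫ • u1, v 2⟫ := by rw [← hw2def]
      _ = ‖v 2‖ ^ 2 - ⟪u0, v 2⟫ ^ 2 - ⟪u1, v 2⟫ ^ 2 := by
          rw [inner_sub_left, inner_sub_left, real_inner_smul_left, real_inner_smul_left,
            real_inner_self_eq_norm_sq]; ring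
  have hw2n : |‖w2‖ ^ 2 - 1| ≤ 2 * η := by
    have h9 : ⟪u0, v 2⟫ ^ 2 ≤ (3 * η) ^ 2 := by
      rw [← sq_abs]; exact pow_le_pow_left₀ (abs_nonneg _) hc0 2
    have h121 : ⟪u1, v 2⟫ ^ 2 ≤ (11 * η) ^ 2 := by
      rw [← sq_abs]; exact pow_le_pow_left₀ (abs_nonneg _) hc1 2
    have := abs_le.mp (hd 2)
    rw [hw2sq, abs_le]
    constructor <;> nlinarith
  obtain ⟨u2, hu2def⟩ : ∃ u2 : E, u2 = (‖w2‖⁻¹ : ℝ) • w2 := ⟨_, rfl⟩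
  obtain ⟨hu2n, hu2d⟩ : ‖u2‖ = 1 ∧ ‖u2 - w2‖ ≤ 2 * η := by
    rw [hu2def]; exact normalize_near w2 (by linarith) hw2n
  have h02 : ⟪u0, u2⟫ = 0 := by rw [hu2def, real_inner_smul_right, hw2o0, mul_zero]
  have h20 : ⟪u2, u0⟫ = 0 := (real_inner_comm u0 u2).trans h02
  have h12 : ⟪u1, u2⟫ = 0 := by rw [hu2def, real_inner_smul_right, hw2o1, mul_zero]
  have h21 : ⟪u2, u1⟫ = 0 := (real_inner_comm u1 u2).trans h12
  have hu2v : ‖u2 - v 2‖ ≤ 16 * η :=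
    calc ‖u2 - v 2‖ = ‖(u2 - w2) + (w2 - v 2)‖ := by rw [sub_add_sub_cancel]
      _ ≤ ‖u2 - w2‖ + ‖w2 - v 2‖ := norm_add_le _ _
      _ ≤ 2 * η + 14 * η := add_le_add hu2d hw2d
      _ = 16 * η := by ring
  refine ⟨![u0, u1, u2], ?_, ?_⟩
  · rw [orthonormal_iff_ite]
    intro k l
    fin_cases k <;> fin_cases l <;> simp [hu0n, hu1n, hu2n, h01, h10, h02, h20, h12, h21]
  · intro k
    fin_cases k
    · simpa using hu0d.trans (by linarith)
    · simpa using hu1v.trans (by linarith)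
    · simpa using hu2v

/-- **A linear isometry near a near-isometry.**  If the triple `v` has Gram matrix `η`-close to the
identity, some linear isometry `A` satisfies `‖A z − Σ_k ⟪e k, z⟫ v k‖² ≤ 768 η² ‖z‖²`. [folklore] -/
theorem exists_isometry_near [FiniteDimensional ℝ E] (e : OrthonormalBasis (Fin 3) ℝ E)
    (v : Fin 3 → E) {η : ℝ} (hη : η ≤ 1 / 200)
    (h : ∀ k l, |⟪v k, v l⟫ - (if k = l then 1 else 0)| ≤ η) :
    ∃ A : E ≃ₗᵢ[ℝ] E, ∀ z : E, ‖A z - ∑ k, ⟪e k, z⟫ • v k‖ ^ 2 ≤ 768 * η ^ 2 * ‖z‖ ^ 2 := by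
  obtain ⟨u, hu, huv⟩ := gramSchmidt_near v hη h
  have hcard : Fintype.card (Fin 3) = Module.finrank ℝ E := by
    rw [Module.finrank_eq_card_basis e.toBasis]
  have hb : ⇑(basisOfOrthonormalOfCardEqFinrank hu hcard) = u :=
    coe_basisOfOrthonormalOfCardEqFinrank hu hcard
  let uB : OrthonormalBasis (Fin 3) ℝ E :=
    (basisOfOrthonormalOfCardEqFinrank hu hcard).toOrthonormalBasis (by rw [hb]; exact hu)
  have huB : ∀ k, uB k = u k := fun k => by
    rw [← hb]; exact congrFun (Module.Basis.coe_toOrthonormalBasis _ _) k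
  refine ⟨e.equiv uB (Equiv.refl _), fun z => ?_⟩
  have hA : e.equiv uB (Equiv.refl _) z = ∑ k, ⟪e k, z⟫ • u k := by
    rw [OrthonormalBasis.equiv_apply]
    simp only [OrthonormalBasis.repr_apply_apply, Equiv.refl_apply, huB]
  rw [hA, ← Finset.sum_sub_distrib]
  simp_rw [← smul_sub]
  have hsq : ∑ k, |⟪e k, z⟫| ^ 2 = ‖z‖ ^ 2 := by
    simp_rw [sq_abs]; exact e.sum_sq_inner_right z
  calc ‖∑ k, ⟪e k, z⟫ • (u k - v k)‖ ^ 2 ≤ (∑ k, |⟪e k, z⟫| * ‖u k - v k‖) ^ 2 := by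
        refine pow_le_pow_left₀ (norm_nonneg _) ((norm_sum_le _ _).trans (le_of_eq ?_)) 2
        simp_rw [norm_smul, Real.norm_eq_abs]
    _ ≤ (∑ k, |⟪e k, z⟫| ^ 2) * ∑ k, ‖u k - v k‖ ^ 2 := Finset.sum_mul_sq_le_sq_mul_sq _ _ _
    _ ≤ ‖z‖ ^ 2 * ∑ _k : Fin 3, (16 * η) ^ 2 := by
        rw [hsq]
        exact mul_le_mul_of_nonneg_left
          (Finset.sum_le_sum fun k _ => pow_le_pow_left₀ (norm_nonneg _) (huv k) 2) (sq_nonneg _)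
    _ = 768 * η ^ 2 * ‖z‖ ^ 2 := by
        simp only [Finset.sum_const, Finset.card_univ, Fintype.card_fin, nsmul_eq_mul]; ring

end Summit.AtomisticToContinuum.Crystallization.Theorems.PalmGoodLaw.Procrustes

end
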